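/-
Copyright: the b2b-balaban T⁴-continuum CRUX team, row NE7b leaf lineage `t4-ne7b-formalise-leaf-03` (gen 145). Project licence.
-/
import Mathlib.Analysis.Calculus.LocalExtr.Basic
import Mathlib.Analysis.Calculus.Deriv.Add
import Mathlib.Analysis.Calculus.Deriv.Mul
import Mathlib.Analysis.Calculus.Deriv.Comp

/-!
# THE ENVELOPE THEOREM FOR THE HARD CONSTRAINT **ON A WINDOW**: the windowed value function
# `φ_K w = inf {V δ : δ ∈ K, D δ = w}` is differentiable at every `w` whose constrained minimiser `δ₀` is an INTERIOR point of the window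
# (`K ∈ 𝓝 δ₀`), with `Dφ_K(w) = DV(δ₀) ∘ M` for any right inverse `M` of `D`, and the first-order letter of `V` ON `K` descends to `φ_K`
# with the constrained Schur form — the windowed companion of `…ConstrainedValueDeriv` (global support letter), in the window currency of
# `…ConstrainedSchurForm` §6 (`{δ // δ ∈ K ∧ D δ = w}`) (row NE7b, node U5c; residual (R2′) family (2), letter (ℓ1) «`λ` ON `K`»; Mathlib only)

Cell `pub-balaban`, sub-cell `t4`, spine estimate NE7b (`T4WeightBudget.RelWeightBound`; the cell's OWN estimate — NOT PRINTED in
[Bałaban 1983–89], NOT PROVED).  Crux-route work under `Spine/NE7b/` by a row leaf on the convexity road; NOTHING of Bałaban's is named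
or asserted; no `T4Continuum/Support` leaf typed (FREEZE (0)); no `def`; zero `sorry`.  Imports: Mathlib only.

WHY.  `…ConstrainedValueDeriv` (this lineage, gen 145, p377468) proves the envelope theorem for `φ w = inf {V δ : D δ = w}` from the
convexity (support) letter of `V` at the minimiser on the WHOLE space.  The road's exponents are convex on a WINDOW only (the chair's reading
ι-X-CVD-1; (A3): print's small-field windows), and `…ConstrainedSchurForm` §6 states the secant inheritance for the WINDOWED value function
`w ↦ inf {V δ : δ ∈ K, D δ = w}`.  THIS FILE is the windowed first-order statement: Fermat on the fibre needs only `K ∈ 𝓝 δ₀`; the lower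
bound needs the support letter ON `K`; the upper bound's competitor `δ₀ + M h` lies in `K` for small `h`; so the squeeze runs EVENTUALLY in
`h` — which is all a derivative asks.

WHAT IS PROVED ([folklore]; Borwein–Lewis (2000) §3.2–§4.3; Rockafellar–Wets Thm 10.13 — localised):
* §1 `deriv_apply_eq_zero_of_isMinOn_window` — `K ∈ 𝓝 δ₀`, `D δ₀ = w`, `V δ₀ ≤ V δ` on `K ∩ {D δ = w}`, `HasFDerivAt V V′ δ₀` ⊢ `V′ κ = 0` on
  `ker D` (the line `δ₀ + tκ` stays in the fibre and, for small `t`, in `K`: a LOCAL minimum at `t = 0`).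
* §2 `firstOrderOn_constrValue` — `V` bounded below on `K`, `Q ≥ 0`, `δ₀ ∈ K` over `w`, `ℓ ⊥ ker D`, the letter
  `V δ₀ + ℓ (δ − δ₀) + Q (δ − δ₀) ≤ V δ` for `δ ∈ K` ⊢ for every `w′` whose window fibre is non-empty:
  `φ_K w + ℓ (M (w′ − w)) + Q_D (w′ − w) ≤ φ_K w′`, `Q_D v = ⨅_{D δ = v} Q δ` (unwindowed, as in `…ConstrainedSchurForm` §6).
* §3 **`hasFDerivAt_constrValue_window`** — `K ∈ 𝓝 δ₀`, `V` bounded below on `K`, `δ₀` minimises `V` on `K ∩ {D δ = w}`,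
  `HasFDerivAt V V′ δ₀`, the support letter ON `K` (`V δ₀ + V′ (δ − δ₀) ≤ V δ` for `δ ∈ K`), `M` a right inverse of `D` ⊢
  `HasFDerivAt φ_K (V′ ∘L M) w`; `fderiv_constrValue_window`; **`firstOrderOn_constrValue_fderiv`** (§2 with `φ_K`'s own derivative).
* §4 a non-vacuity `example` (`K = univ`, `D = M = id`).
* §5 (v2, appended) THE INTERIOR MINIMISER FROM THE DATA (proper `E`): `lt_of_firstOrderOn_of_norm_gt`, `bddBelowOn_of_firstOrderOn`,
  **`exists_isMinOn_window_ball`** (`R ≥ 2‖ℓ‖∕m`, `V` continuous on `closedBall δ₁ R`, the strong letter at the fibre point `δ₁` for the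
  points of `K` ⊢ a minimiser over `K ∩ fibre` inside `closedBall δ₁ R`), `window_mem_nhds_of_margin` (`R < R′`, `closedBall δ₁ R′ ⊆ K` ⊢ `K ∈ 𝓝 δ₀`),
  **`hasFDerivAt_constrValue_window_of_margin`** (every hypothesis of §3 discharged from `(V′, Q, D, M, K)` + the margin `2‖V′ δ₁‖∕m ≤ R < R′`).
  (v2 note: with §5 the «existence ∕ interiority of `δ₀`» item of NOT HERE below is reduced to the margin condition; which margin print's windows
  carry stays (A3).)
* §6 (v2, appended) `eq_of_isMinOn_window` — UNIQUENESS of the constrained minimiser under the strong letter (Fermat kills the linear term), so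
  `δ₀ = δ₀(w)` and §3's derivative `V′(δ₀(w)) ∘ M` is a function of `w`.
* §7 (v2, appended) `firstOrderOn_constrValue_sq` — the END in the SOCKETS' shape `φ_K w + Dφ_K(w)(w′ − w) + (λ∕2)‖w′ − w‖² ≤ φ_K w′` from a
  displayed quadratic floor `(λ∕2)‖·‖² ≤ Q_D` (supplied by `…ConstrainedSchurForm` §2 `floor_constrInf` by name when built).
The support letter on `K` is SUPPLIED by name elsewhere on the road (`…StrongConvexFirstOrderWithin` §1 at `m = 0`,
`…LogConcaveMarginal` §5, `…HessianFormFirstOrder`) — displayed here, not re-derived.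

NOT HERE (honest): minimisers on the BOUNDARY of `K` (one-sided derivatives only); existence ∕ interiority of `δ₀` (the road chooses its
window around the minimiser — (A3)); second-order sensitivity; nonlinear constraints; which `V`, `D`, `K` of Bałaban's ((A3) ∕ (A1c),
NC-NE7b-α UNRULED); any value.  BY-NAME EFFECT ON THE WALL: NONE.  NE7b NOT PRINTED ∕ NOT PROVED; spine PROVED 0∕9; rung (B)+1 on a FINITE
torus — NOT infinite volume, NOT the mass gap, NOT Clay.  HONEST DEPENDENCY: continuum YM on T⁴ ⇐ BetaPertH ∧ nine spine estimates (0/9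
proved); BetaPertH ⇐ (D1) ∧ (D4) ∧ CAP+tail.
-/

set_option autoImplicit false

open Set Function Filter Asymptotics
open scoped Topology
namespace Summit.QuantumFields.BalabanUV.T4Continuum.NE7b.ConstrainedValueWindow

variable {E F : Type*} [NormedAddCommGroup E] [NormedSpace ℝ E] [NormedAddCommGroup F] [NormedSpace ℝ F]

/-! ## §1 Fermat on the fibre, windowed: an interior constrained minimiser annihilates `ker D` -/

/-- **FERMAT ON THE FIBRE, ON A WINDOW.**  `K ∈ 𝓝 δ₀`, `δ₀` minimises `V` on `K ∩ {D δ = w}`, `HasFDerivAt V V′ δ₀` ⟹ `V′ κ = 0` for every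
`κ ∈ ker D`: the line `t ↦ δ₀ + t • κ` stays in the fibre and enters `K` for small `t`, so `t ↦ V (δ₀ + t • κ)` has a LOCAL minimum at `0`.
[folklore] -/
theorem deriv_apply_eq_zero_of_isMinOn_window {V : E → ℝ} {V' : E →L[ℝ] ℝ} {D : E →L[ℝ] F} {K : Set E} {w : F} {δ₀ : E}
    (hK : K ∈ 𝓝 δ₀) (hδ₀ : D δ₀ = w) (hmin : ∀ δ ∈ K, D δ = w → V δ₀ ≤ V δ) (hV : HasFDerivAt V V' δ₀) {κ : E} (hκ : D κ = 0) :
    V' κ = 0 := by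
  have hline : HasDerivAt (fun t : ℝ => δ₀ + t • κ) κ 0 := by simpa using ((hasDerivAt_id (0 : ℝ)).smul_const κ).const_add δ₀
  have hV0 : HasFDerivAt V V' (δ₀ + (0 : ℝ) • κ) := by simpa using hV
  have hg := hV0.comp_hasDerivAt (0 : ℝ) hline
  have hmemK : ∀ᶠ t : ℝ in 𝓝 0, δ₀ + t • κ ∈ K := by
    have ht : Tendsto (fun t : ℝ => δ₀ + t • κ) (𝓝 0) (𝓝 δ₀) := by
      simpa using hline.continuousAt.tendsto
    exact ht.eventually_mem hK
  have hloc : IsLocalMin (V ∘ fun t : ℝ => δ₀ + t • κ) 0 :=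
    hmemK.mono fun t ht => by
      simpa using hmin (δ₀ + t • κ) ht (by rw [map_add, map_smul, hκ, smul_zero, add_zero, hδ₀])
  exact hloc.hasDerivAt_eq_zero hg

/-! ## §2 The first-order letter ON THE WINDOW descends to the windowed value function -/

/-- **THE FIRST-ORDER LETTER OF `V` ON `K` DESCENDS TO `φ_K w = ⨅ {V δ : δ ∈ K, D δ = w}`.**  `V` bounded below on `K`, `Q ≥ 0`, `M` a
right inverse of `D`, `δ₀ ∈ K` a fibre point of `w` at which `ℓ` annihilates `ker D` and the letter
`V δ₀ + ℓ (δ − δ₀) + Q (δ − δ₀) ≤ V δ` holds for `δ ∈ K` ⟹ for every `w′` with a non-empty window fibre: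
`φ_K w + ℓ (M (w′ − w)) + Q_D (w′ − w) ≤ φ_K w′`, `Q_D v = ⨅_{D δ = v} Q δ` (the unwindowed constrained Schur form, as in
`…ConstrainedSchurForm` §6). [folklore] -/
theorem firstOrderOn_constrValue {V Q : E → ℝ} {ℓ : E →L[ℝ] ℝ} {D : E →L[ℝ] F} {M : F →L[ℝ] E} (hM : ∀ w, D (M w) = w)
    {K : Set E} (hbdd : ∃ m, ∀ δ ∈ K, m ≤ V δ) (hQ0 : ∀ δ, 0 ≤ Q δ) {w : F} {δ₀ : E} (hδ₀K : δ₀ ∈ K) (hδ₀ : D δ₀ = w)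
    (hker : ∀ κ, D κ = 0 → ℓ κ = 0) (hfo : ∀ δ ∈ K, V δ₀ + ℓ (δ - δ₀) + Q (δ - δ₀) ≤ V δ) {w' : F} (hw' : ∃ δ ∈ K, D δ = w') :
    (⨅ δ : {δ // δ ∈ K ∧ D δ = w}, V δ.1) + ℓ (M (w' - w)) + (⨅ δ : {δ // D δ = w' - w}, Q δ.1)
      ≤ ⨅ δ : {δ // δ ∈ K ∧ D δ = w'}, V δ.1 := by
  obtain ⟨m, hm⟩ := hbdd
  obtain ⟨δ₁, hδ₁K, hδ₁⟩ := hw'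
  haveI : Nonempty {δ // δ ∈ K ∧ D δ = w'} := ⟨⟨δ₁, hδ₁K, hδ₁⟩⟩
  have hbddV : ∀ v, BddBelow (range fun δ : {δ // δ ∈ K ∧ D δ = v} => V δ.1) :=
    fun v => ⟨m, forall_mem_range.2 fun δ => hm δ.1 δ.2.1⟩
  have hbddQ : ∀ v, BddBelow (range fun δ : {δ // D δ = v} => Q δ.1) := fun v => ⟨0, forall_mem_range.2 fun δ => hQ0 δ.1⟩
  have hφw : (⨅ δ : {δ // δ ∈ K ∧ D δ = w}, V δ.1) ≤ V δ₀ := ciInf_le (hbddV w) ⟨δ₀, hδ₀K, hδ₀⟩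
  have key : ∀ δ : {δ // δ ∈ K ∧ D δ = w'}, V δ₀ + ℓ (M (w' - w)) + (⨅ δ' : {δ' // D δ' = w' - w}, Q δ'.1) ≤ V δ.1 := by
    rintro ⟨δ, hδK, hδ⟩
    -- every fibre point reads the same linear term: `δ − δ₀ − M (w′ − w) ∈ ker D` (`…ConstrainedValueDeriv` §2)
    have h1 : ℓ (δ - δ₀) = ℓ (M (w' - w)) := by
      have h0 := hker (δ - δ₀ - M (w' - w)) (by rw [map_sub, map_sub, hδ, hδ₀, hM, sub_self])
      rwa [map_sub, sub_eq_zero] at h0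
    have h2 : (⨅ δ' : {δ' // D δ' = w' - w}, Q δ'.1) ≤ Q (δ - δ₀) := ciInf_le (hbddQ _) ⟨δ - δ₀, by rw [map_sub, hδ, hδ₀]⟩
    have h3 := hfo δ hδK
    rw [h1] at h3
    linarith
  linarith [le_ciInf key]

/-! ## §3 THE WINDOWED ENVELOPE THEOREM -/

/-- The windowed value at `w` is attained at the constrained minimiser. [folklore] -/
theorem constrValue_window_eq {V : E → ℝ} {D : E →L[ℝ] F} {K : Set E} (hbdd : ∃ m, ∀ δ ∈ K, m ≤ V δ) {w : F} {δ₀ : E}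
    (hδ₀K : δ₀ ∈ K) (hδ₀ : D δ₀ = w) (hmin : ∀ δ ∈ K, D δ = w → V δ₀ ≤ V δ) :
    (⨅ δ : {δ // δ ∈ K ∧ D δ = w}, V δ.1) = V δ₀ := by
  obtain ⟨m, hm⟩ := hbdd
  haveI : Nonempty {δ // δ ∈ K ∧ D δ = w} := ⟨⟨δ₀, hδ₀K, hδ₀⟩⟩
  have hb : BddBelow (range fun δ : {δ // δ ∈ K ∧ D δ = w} => V δ.1) := ⟨m, forall_mem_range.2 fun δ => hm δ.1 δ.2.1⟩
  exact le_antisymm (ciInf_le hb ⟨δ₀, hδ₀K, hδ₀⟩) (le_ciInf fun δ => hmin δ.1 δ.2.1 δ.2.2)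

/-- **THE ENVELOPE THEOREM ON A WINDOW.**  `K ∈ 𝓝 δ₀` (interior minimiser), `V` bounded below on `K`, `δ₀` minimises `V` on
`K ∩ {D δ = w}`, `HasFDerivAt V V′ δ₀`, the support letter ON `K` (`V δ₀ + V′ (δ − δ₀) ≤ V δ` for `δ ∈ K`), `M` a continuous linear right
inverse of `D` ⟹ `φ_K w′ = ⨅ {V δ : δ ∈ K, D δ = w′}` is Fréchet differentiable at `w` with derivative `V′ ∘L M`.  For small `h` the
competitor `δ₀ + M h` lies in `K`, so `0 ≤ φ_K (w + h) − φ_K w − V′ (M h) ≤ V (δ₀ + M h) − V δ₀ − V′ (M h) = o(h)` EVENTUALLY. [folklore] -/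
theorem hasFDerivAt_constrValue_window {V : E → ℝ} {V' : E →L[ℝ] ℝ} {D : E →L[ℝ] F} {M : F →L[ℝ] E} (hM : ∀ w, D (M w) = w)
    {K : Set E} {w : F} {δ₀ : E} (hK : K ∈ 𝓝 δ₀) (hbdd : ∃ m, ∀ δ ∈ K, m ≤ V δ) (hδ₀ : D δ₀ = w)
    (hmin : ∀ δ ∈ K, D δ = w → V δ₀ ≤ V δ) (hV : HasFDerivAt V V' δ₀) (hconv : ∀ δ ∈ K, V δ₀ + V' (δ - δ₀) ≤ V δ) :
    HasFDerivAt (fun w' => ⨅ δ : {δ // δ ∈ K ∧ D δ = w'}, V δ.1) (V'.comp M) w := by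
  have hδ₀K : δ₀ ∈ K := mem_of_mem_nhds hK
  have hφw : (⨅ δ : {δ // δ ∈ K ∧ D δ = w}, V δ.1) = V δ₀ := constrValue_window_eq hbdd hδ₀K hδ₀ hmin
  obtain ⟨m, hm⟩ := hbdd
  have hbddV : ∀ v, BddBelow (range fun δ : {δ // δ ∈ K ∧ D δ = v} => V δ.1) :=
    fun v => ⟨m, forall_mem_range.2 fun δ => hm δ.1 δ.2.1⟩
  have hker : ∀ κ, D κ = 0 → V' κ = 0 := fun κ hκ => deriv_apply_eq_zero_of_isMinOn_window hK hδ₀ hmin hV hκ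
  -- the competitor `δ₀ + M h` enters the window for small `h`
  have hev : ∀ᶠ h : F in 𝓝 0, δ₀ + M h ∈ K := by
    have ht : Tendsto (fun h : F => δ₀ + M h) (𝓝 0) (𝓝 δ₀) := by
      simpa using ((M.continuous.const_add δ₀).tendsto (0 : F))
    exact ht.eventually_mem hK
  have hlow : ∀ᶠ h : F in 𝓝 0,
      0 ≤ (⨅ δ : {δ // δ ∈ K ∧ D δ = w + h}, V δ.1) - (⨅ δ : {δ // δ ∈ K ∧ D δ = w}, V δ.1) - (V'.comp M) h := by
    refine hev.mono fun h hh => ?_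
    have hfo : ∀ δ ∈ K, V δ₀ + V' (δ - δ₀) + (fun _ : E => (0 : ℝ)) (δ - δ₀) ≤ V δ := fun δ hδ => by simpa using hconv δ hδ
    have h1 := firstOrderOn_constrValue hM ⟨m, hm⟩ (fun _ => le_rfl) hδ₀K hδ₀ hker hfo
      (w' := w + h) ⟨δ₀ + M h, hh, by rw [map_add, hδ₀, hM]⟩
    have h0 : (⨅ δ : {δ // D δ = w + h - w}, (fun _ : E => (0 : ℝ)) δ.1) = 0 := by
      haveI : Nonempty {δ // D δ = w + h - w} := ⟨⟨M (w + h - w), hM _⟩⟩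
      exact ciInf_const
    rw [h0, add_zero, add_sub_cancel_left] at h1
    rw [ContinuousLinearMap.comp_apply]
    linarith
  have hup : ∀ᶠ h : F in 𝓝 0, (⨅ δ : {δ // δ ∈ K ∧ D δ = w + h}, V δ.1) - (⨅ δ : {δ // δ ∈ K ∧ D δ = w}, V δ.1) - (V'.comp M) h
      ≤ V (δ₀ + M h) - V δ₀ - (V'.comp M) h := by
    refine hev.mono fun h hh => ?_
    have h1 : (⨅ δ : {δ // δ ∈ K ∧ D δ = w + h}, V δ.1) ≤ V (δ₀ + M h) :=
      ciInf_le (hbddV _) ⟨δ₀ + M h, hh, by rw [map_add, hδ₀, hM]⟩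
    rw [hφw]
    linarith
  have hs : (fun h : F => V (δ₀ + M h) - V δ₀ - (V'.comp M) h) =o[𝓝 0] fun h => h := by
    have h1 : HasFDerivAt (fun h : F => δ₀ + M h) M 0 := (M.hasFDerivAt).const_add δ₀
    have h2 : HasFDerivAt V V' (δ₀ + M 0) := by simpa using hV
    have h3 := hasFDerivAt_iff_isLittleO_nhds_zero.1 (h2.comp (0 : F) h1)
    simpa using h3
  have hr : (fun h : F => (⨅ δ : {δ // δ ∈ K ∧ D δ = w + h}, V δ.1) - (⨅ δ : {δ // δ ∈ K ∧ D δ = w}, V δ.1) - (V'.comp M) h)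
      =o[𝓝 0] fun h => h := by
    refine (IsBigO.of_bound 1 ?_).trans_isLittleO hs
    filter_upwards [hlow, hup] with h hl hu
    rw [one_mul, Real.norm_of_nonneg hl, Real.norm_of_nonneg (hl.trans hu)]
    exact hu
  exact hasFDerivAt_iff_isLittleO_nhds_zero.2 hr

/-- `fderiv` form of the windowed envelope theorem. [folklore] -/
theorem fderiv_constrValue_window {V : E → ℝ} {V' : E →L[ℝ] ℝ} {D : E →L[ℝ] F} {M : F →L[ℝ] E} (hM : ∀ w, D (M w) = w)
    {K : Set E} {w : F} {δ₀ : E} (hK : K ∈ 𝓝 δ₀) (hbdd : ∃ m, ∀ δ ∈ K, m ≤ V δ) (hδ₀ : D δ₀ = w)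
    (hmin : ∀ δ ∈ K, D δ = w → V δ₀ ≤ V δ) (hV : HasFDerivAt V V' δ₀) (hconv : ∀ δ ∈ K, V δ₀ + V' (δ - δ₀) ≤ V δ) :
    fderiv ℝ (fun w' => ⨅ δ : {δ // δ ∈ K ∧ D δ = w'}, V δ.1) w = V'.comp M :=
  (hasFDerivAt_constrValue_window hM hK hbdd hδ₀ hmin hV hconv).fderiv

/-- **THE END: THE ROAD's FIRST-ORDER LETTER FOR THE WINDOWED CONSTRAINED VALUE FUNCTION, WITH ITS OWN DERIVATIVE AND THE CONSTRAINED
SCHUR MODULUS.**  `K ∈ 𝓝 δ₀`, `V` bounded below on `K`, `Q ≥ 0`, `δ₀` a constrained minimiser over `w` in `K`, `HasFDerivAt V V′ δ₀` and the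
first-order letter of `V` at `δ₀` ON `K` with modulus form `Q` ⟹ for every `w′` with a non-empty window fibre:
`φ_K w + fderiv ℝ φ_K w (w′ − w) + Q_D (w′ − w) ≤ φ_K w′`. [folklore] -/
theorem firstOrderOn_constrValue_fderiv {V Q : E → ℝ} {V' : E →L[ℝ] ℝ} {D : E →L[ℝ] F} {M : F →L[ℝ] E} (hM : ∀ w, D (M w) = w)
    {K : Set E} {w : F} {δ₀ : E} (hK : K ∈ 𝓝 δ₀) (hbdd : ∃ m, ∀ δ ∈ K, m ≤ V δ) (hQ0 : ∀ δ, 0 ≤ Q δ) (hδ₀ : D δ₀ = w)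
    (hmin : ∀ δ ∈ K, D δ = w → V δ₀ ≤ V δ) (hV : HasFDerivAt V V' δ₀)
    (hfo : ∀ δ ∈ K, V δ₀ + V' (δ - δ₀) + Q (δ - δ₀) ≤ V δ) {w' : F} (hw' : ∃ δ ∈ K, D δ = w') :
    (⨅ δ : {δ // δ ∈ K ∧ D δ = w}, V δ.1) + fderiv ℝ (fun v => ⨅ δ : {δ // δ ∈ K ∧ D δ = v}, V δ.1) w (w' - w)
      + (⨅ δ : {δ // D δ = w' - w}, Q δ.1) ≤ ⨅ δ : {δ // δ ∈ K ∧ D δ = w'}, V δ.1 := by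
  have hconv : ∀ δ ∈ K, V δ₀ + V' (δ - δ₀) ≤ V δ := fun δ hδ => by linarith [hfo δ hδ, hQ0 (δ - δ₀)]
  rw [fderiv_constrValue_window hM hK hbdd hδ₀ hmin hV hconv, ContinuousLinearMap.comp_apply]
  exact firstOrderOn_constrValue hM hbdd hQ0 (mem_of_mem_nhds hK) hδ₀
    (fun κ hκ => deriv_apply_eq_zero_of_isMinOn_window hK hδ₀ hmin hV hκ) hfo hw'

/-! ## §4 Toy check (kernel): the letters are jointly inhabited — `K = univ`, `D = M = id`, `φ_K = V` -/

example {V : E → ℝ} {V' : E →L[ℝ] ℝ} (hbdd : ∃ m, ∀ δ, m ≤ V δ) {w : E} (hV : HasFDerivAt V V' w)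
    (hconv : ∀ δ, V w + V' (δ - w) ≤ V δ) :
    HasFDerivAt (fun w' => ⨅ δ : {δ // δ ∈ (univ : Set E) ∧ (ContinuousLinearMap.id ℝ E) δ = w'}, V δ.1)
      (V'.comp (ContinuousLinearMap.id ℝ E)) w :=
  hasFDerivAt_constrValue_window (D := ContinuousLinearMap.id ℝ E) (M := ContinuousLinearMap.id ℝ E) (fun _ => rfl)
    (K := univ) univ_mem (hbdd.imp fun _ hm δ _ => hm δ) rfl
    (fun δ _ hδ => by
      have hδ' : δ = w := hδ
      rw [hδ'])
    hV (fun δ _ => hconv δ)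

/-! ## §5 (v2, appended) THE INTERIOR MINIMISER FROM THE DATA: a strong letter at a fibre point `δ₁` whose ball of radius
`2‖ℓ‖∕m` (plus a margin) sits inside the window puts the constrained minimiser inside that ball — `K ∈ 𝓝 δ₀` becomes a margin condition -/

/-- COERCIVITY ON THE WINDOW: the strong letter at `δ₁` for the points of `K` gives `V δ₁ < V δ` once `δ ∈ K` and `‖δ − δ₁‖ > 2‖ℓ‖∕m`
(SHARP threshold). [folklore] -/
theorem lt_of_firstOrderOn_of_norm_gt {V : E → ℝ} {ℓ : E →L[ℝ] ℝ} {m : ℝ} (hm : 0 < m) {K : Set E} {δ₁ : E}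
    (hfo : ∀ δ ∈ K, V δ₁ + ℓ (δ - δ₁) + m / 2 * ‖δ - δ₁‖ ^ 2 ≤ V δ) {δ : E} (hδK : δ ∈ K) (hδ : 2 * ‖ℓ‖ / m < ‖δ - δ₁‖) :
    V δ₁ < V δ := by
  have h1 : -(‖ℓ‖ * ‖δ - δ₁‖) ≤ ℓ (δ - δ₁) := by
    have := ℓ.le_opNorm (δ - δ₁)
    rw [Real.norm_eq_abs] at this
    linarith [neg_abs_le (ℓ (δ - δ₁))]
  have h2 : 2 * ‖ℓ‖ < m * ‖δ - δ₁‖ := by linarith [(div_lt_iff₀ hm).1 hδ]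
  have h3 : 0 < ‖δ - δ₁‖ := lt_of_le_of_lt (by positivity) hδ
  nlinarith [hfo δ hδK, norm_nonneg ℓ]

/-- BOUNDED BELOW ON THE WINDOW from the strong letter at one point: `V ≥ V δ₁ − ‖ℓ‖²∕(2m)` on `K`. [folklore] -/
theorem bddBelowOn_of_firstOrderOn {V : E → ℝ} {ℓ : E →L[ℝ] ℝ} {m : ℝ} (hm : 0 < m) {K : Set E} {δ₁ : E}
    (hfo : ∀ δ ∈ K, V δ₁ + ℓ (δ - δ₁) + m / 2 * ‖δ - δ₁‖ ^ 2 ≤ V δ) : ∃ c, ∀ δ ∈ K, c ≤ V δ := by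
  refine ⟨V δ₁ - ‖ℓ‖ ^ 2 / (2 * m), fun δ hδK => ?_⟩
  have h1 : -(‖ℓ‖ * ‖δ - δ₁‖) ≤ ℓ (δ - δ₁) := by
    have := ℓ.le_opNorm (δ - δ₁)
    rw [Real.norm_eq_abs] at this
    linarith [neg_abs_le (ℓ (δ - δ₁))]
  have h2 : ‖ℓ‖ * ‖δ - δ₁‖ ≤ ‖ℓ‖ ^ 2 / (2 * m) + m / 2 * ‖δ - δ₁‖ ^ 2 := by
    rw [← sub_nonneg]
    have : ‖ℓ‖ ^ 2 / (2 * m) + m / 2 * ‖δ - δ₁‖ ^ 2 - ‖ℓ‖ * ‖δ - δ₁‖ = (‖ℓ‖ - m * ‖δ - δ₁‖) ^ 2 / (2 * m) := by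
      field_simp
      ring
    rw [this]
    positivity
  linarith [hfo δ hδK]

/-- **A MINIMISER OVER `K ∩ {D δ = w}` SITS IN THE BALL `closedBall δ₁ R`, `R ≥ 2‖ℓ‖∕m`** (proper `E`): a fibre point `δ₁` of `w`, `V`
continuous on its closed `R`-ball, the strong letter at `δ₁` for the points of `K` ⟹ `∃ δ₀ ∈ closedBall δ₁ R` on the fibre with `V δ₀ ≤ V δ`
for every `δ ∈ K` on the fibre (minimise on the compact `closedBall δ₁ R ∩ fibre`; outside the ball `V > V δ₁`; `δ₀ ∈ K` once the ball lies
in `K` — `…_of_margin`). [folklore] -/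
theorem exists_isMinOn_window_ball [ProperSpace E] {V : E → ℝ} {ℓ : E →L[ℝ] ℝ} {m R : ℝ} (hm : 0 < m) {D : E →L[ℝ] F} {K : Set E}
    {w : F} {δ₁ : E} (hδ₁ : D δ₁ = w) (hR : 2 * ‖ℓ‖ / m ≤ R) (hVc : ContinuousOn V (Metric.closedBall δ₁ R))
    (hfo : ∀ δ ∈ K, V δ₁ + ℓ (δ - δ₁) + m / 2 * ‖δ - δ₁‖ ^ 2 ≤ V δ) :
    ∃ δ₀ ∈ Metric.closedBall δ₁ R, D δ₀ = w ∧ ∀ δ ∈ K, D δ = w → V δ₀ ≤ V δ := by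
  have hR0 : 0 ≤ R := le_trans (by positivity) hR
  set C : Set E := Metric.closedBall δ₁ R ∩ {δ | D δ = w} with hC
  have hCc : IsCompact C := (isCompact_closedBall δ₁ R).inter_right (isClosed_eq D.continuous continuous_const)
  have hδ₁C : δ₁ ∈ C := ⟨Metric.mem_closedBall_self hR0, hδ₁⟩
  obtain ⟨δ₀, ⟨hδ₀B, hδ₀D⟩, hδ₀⟩ := hCc.exists_isMinOn ⟨δ₁, hδ₁C⟩ (hVc.mono Set.inter_subset_left)
  refine ⟨δ₀, hδ₀B, hδ₀D, fun δ hδK hδ => ?_⟩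
  by_cases hb : ‖δ - δ₁‖ ≤ R
  · exact hδ₀ ⟨by rwa [Metric.mem_closedBall, dist_eq_norm], hδ⟩
  · have h1 : V δ₁ < V δ := lt_of_firstOrderOn_of_norm_gt hm hfo hδK (lt_of_le_of_lt hR (lt_of_not_ge hb))
    have h2 : V δ₀ ≤ V δ₁ := hδ₀ hδ₁C
    linarith

omit [NormedSpace ℝ E] in
/-- **THE MARGIN MAKES THE MINIMISER INTERIOR**: `δ₀ ∈ closedBall δ₁ R`, `R < R′`, `closedBall δ₁ R′ ⊆ K` ⟹ `K ∈ 𝓝 δ₀`. [folklore] -/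
theorem window_mem_nhds_of_margin {K : Set E} {δ₀ δ₁ : E} {R R' : ℝ} (h : δ₀ ∈ Metric.closedBall δ₁ R) (hRR' : R < R')
    (hball' : Metric.closedBall δ₁ R' ⊆ K) : K ∈ 𝓝 δ₀ := by
  refine Filter.mem_of_superset (Metric.ball_mem_nhds δ₀ (sub_pos.2 hRR')) fun x hx => hball' ?_
  rw [Metric.mem_closedBall]
  rw [Metric.mem_ball] at hx
  rw [Metric.mem_closedBall] at h
  linarith [dist_triangle x δ₀ δ₁]

/-- **THE WINDOWED ENVELOPE THEOREM FROM THE STEP's DATA AND A MARGIN** (proper `E`): a derivative FIELD `V′` on `K` with the strong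
first-order letter between points of `K` (modulus `Q ≥ (m∕2)‖·‖²`, `m > 0`), a fibre point `δ₁` of `w` in `K` with
`closedBall δ₁ R′ ⊆ K` and `2‖V′ δ₁‖∕m ≤ R < R′` ⟹ a constrained minimiser `δ₀ ∈ closedBall δ₁ R` over `w` EXISTS, is INTERIOR, and
`HasFDerivAt φ_K (V′ δ₀ ∘L M) w` — every hypothesis of §3 discharged from `(V′, Q, D, M, K)` and the margin. [folklore] -/
theorem hasFDerivAt_constrValue_window_of_margin [ProperSpace E] {V Q : E → ℝ} {V' : E → E →L[ℝ] ℝ} {D : E →L[ℝ] F}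
    {M : F →L[ℝ] E} (hM : ∀ w, D (M w) = w) {K : Set E} (hV : ∀ δ ∈ K, HasFDerivAt V (V' δ) δ) {m : ℝ} (hm : 0 < m)
    (hQ : ∀ δ, m / 2 * ‖δ‖ ^ 2 ≤ Q δ) (hfo : ∀ δ ∈ K, ∀ δ' ∈ K, V δ + V' δ (δ' - δ) + Q (δ' - δ) ≤ V δ')
    {w : F} {δ₁ : E} (hδ₁ : D δ₁ = w) {R R' : ℝ} (hR : 2 * ‖V' δ₁‖ / m ≤ R) (hRR' : R < R')
    (hball' : Metric.closedBall δ₁ R' ⊆ K) :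
    ∃ δ₀ ∈ Metric.closedBall δ₁ R, D δ₀ = w ∧ (∀ δ ∈ K, D δ = w → V δ₀ ≤ V δ) ∧
      HasFDerivAt (fun w' => ⨅ δ : {δ // δ ∈ K ∧ D δ = w'}, V δ.1) ((V' δ₀).comp M) w := by
  have hball : Metric.closedBall δ₁ R ⊆ K := (Metric.closedBall_subset_closedBall hRR'.le).trans hball'
  have hδ₁K : δ₁ ∈ K := hball' (Metric.mem_closedBall_self (le_trans (le_trans (by positivity) hR) hRR'.le))
  have hfo' : ∀ δ ∈ K, ∀ δ' ∈ K, V δ + V' δ (δ' - δ) + m / 2 * ‖δ' - δ‖ ^ 2 ≤ V δ' :=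
    fun δ hδ δ' hδ' => by linarith [hfo δ hδ δ' hδ', hQ (δ' - δ)]
  have hVc : ContinuousOn V (Metric.closedBall δ₁ R) :=
    fun δ hδ => ((hV δ (hball hδ)).continuousAt).continuousWithinAt
  obtain ⟨δ₀, hδ₀B, hδ₀D, hmin⟩ := exists_isMinOn_window_ball hm hδ₁ hR hVc (hfo' δ₁ hδ₁K)
  have hK : K ∈ 𝓝 δ₀ := window_mem_nhds_of_margin hδ₀B hRR' hball'
  have hδ₀K : δ₀ ∈ K := mem_of_mem_nhds hK
  have hQ0 : ∀ δ, 0 ≤ Q δ := fun δ => le_trans (by positivity) (hQ δ)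
  exact ⟨δ₀, hδ₀B, hδ₀D, hmin, hasFDerivAt_constrValue_window hM hK (bddBelowOn_of_firstOrderOn hm (hfo' δ₀ hδ₀K)) hδ₀D hmin
    (hV δ₀ hδ₀K) fun δ hδ => by linarith [hfo δ₀ hδ₀K δ hδ, hQ0 (δ - δ₀)]⟩

/-! ## §6 (v2, appended) UNIQUENESS: under the strong letter the constrained minimiser over `w` is unique, so `δ₀ = δ₀(w)` and the
derivative `V′(δ₀(w)) ∘ M` of §3 ∕ §5 is a well-defined function of `w` -/

/-- **THE CONSTRAINED MINIMISER IS UNIQUE** (strong letter): `δ₀, δ₀′ ∈ K` both minimise `V` on `K ∩ {D δ = w}`, `K ∈ 𝓝 δ₀`,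
`HasFDerivAt V V′ δ₀` and the strong letter at `δ₀` for the points of `K` with `m > 0` ⟹ `δ₀′ = δ₀`: Fermat on the fibre kills the
linear term (`δ₀′ − δ₀ ∈ ker D`), so `V δ₀ + (m∕2)‖δ₀′ − δ₀‖² ≤ V δ₀′ ≤ V δ₀`. [folklore] -/
theorem eq_of_isMinOn_window {V : E → ℝ} {V' : E →L[ℝ] ℝ} {D : E →L[ℝ] F} {K : Set E} {w : F} {δ₀ δ₀' : E} {m : ℝ} (hm : 0 < m)
    (hK : K ∈ 𝓝 δ₀) (hδ₀ : D δ₀ = w) (hmin : ∀ δ ∈ K, D δ = w → V δ₀ ≤ V δ) (hV : HasFDerivAt V V' δ₀)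
    (hfo : ∀ δ ∈ K, V δ₀ + V' (δ - δ₀) + m / 2 * ‖δ - δ₀‖ ^ 2 ≤ V δ)
    (hδ₀'K : δ₀' ∈ K) (hδ₀' : D δ₀' = w) (hmin' : ∀ δ ∈ K, D δ = w → V δ₀' ≤ V δ) : δ₀' = δ₀ := by
  have hker : V' (δ₀' - δ₀) = 0 :=
    deriv_apply_eq_zero_of_isMinOn_window hK hδ₀ hmin hV (by rw [map_sub, hδ₀', hδ₀, sub_self])
  have h1 := hfo δ₀' hδ₀'K
  have h2 := hmin' δ₀ (mem_of_mem_nhds hK) hδ₀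
  rw [hker] at h1
  have h3 : ‖δ₀' - δ₀‖ ^ 2 ≤ 0 := by nlinarith
  have h4 : ‖δ₀' - δ₀‖ = 0 := by nlinarith [norm_nonneg (δ₀' - δ₀)]
  rwa [norm_eq_zero, sub_eq_zero] at h4

/-! ## §7 (v2, appended) SOCKET SHAPE: a quadratic floor of the constrained Schur form turns the END into the road's
`φ + Dφ·(w′ − w) + (λ∕2)‖w′ − w‖² ≤ φ(w′)` letter (`…ConstrainedSchurForm` §2 `floor_constrInf` supplies the floor: `λ∕2 = γ∕q²` for
`Q ≥ γ‖·‖²`, `‖D‖ ≤ q`) -/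

/-- **THE END IN THE SOCKETS' SHAPE.**  Hypotheses of `firstOrderOn_constrValue_fderiv` plus a displayed quadratic floor of the constrained
Schur form, `(λ∕2)‖v‖² ≤ Q_D v` ⟹ for every `w′` with a non-empty window fibre:
`φ_K w + fderiv ℝ φ_K w (w′ − w) + (λ∕2)‖w′ − w‖² ≤ φ_K w′` — the first-order uniform-convexity letter `hV` of the road's sockets, for the
windowed constrained value function (gradient currency is one `InnerProductSpace.toDual_symm_apply` away on an inner product space). [folklore] -/
theorem firstOrderOn_constrValue_sq {V Q : E → ℝ} {V' : E →L[ℝ] ℝ} {D : E →L[ℝ] F} {M : F →L[ℝ] E} (hM : ∀ w, D (M w) = w)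
    {K : Set E} {w : F} {δ₀ : E} (hK : K ∈ 𝓝 δ₀) (hbdd : ∃ m, ∀ δ ∈ K, m ≤ V δ) (hQ0 : ∀ δ, 0 ≤ Q δ) (hδ₀ : D δ₀ = w)
    (hmin : ∀ δ ∈ K, D δ = w → V δ₀ ≤ V δ) (hV : HasFDerivAt V V' δ₀)
    (hfo : ∀ δ ∈ K, V δ₀ + V' (δ - δ₀) + Q (δ - δ₀) ≤ V δ) {lam : ℝ} (hQD : ∀ v : F, lam / 2 * ‖v‖ ^ 2 ≤ ⨅ δ : {δ // D δ = v}, Q δ.1)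
    {w' : F} (hw' : ∃ δ ∈ K, D δ = w') :
    (⨅ δ : {δ // δ ∈ K ∧ D δ = w}, V δ.1) + fderiv ℝ (fun v => ⨅ δ : {δ // δ ∈ K ∧ D δ = v}, V δ.1) w (w' - w)
      + lam / 2 * ‖w' - w‖ ^ 2 ≤ ⨅ δ : {δ // δ ∈ K ∧ D δ = w'}, V δ.1 := by
  linarith [firstOrderOn_constrValue_fderiv hM hK hbdd hQ0 hδ₀ hmin hV hfo hw', hQD (w' - w)]

end Summit.QuantumFields.BalabanUV.T4Continuum.NE7b.ConstrainedValueWindow
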